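import Literature.NumberTheory.Automorphic.Liu2021.AppendixC.HeckeEndomorphismComplexWord
import Literature.NumberTheory.Automorphic.Liu2021.AppendixC.HeckeEndomorphismSingleTranslate
import Literature.NumberTheory.Automorphic.Liu2021.AppendixC.HeckeImage
import Literature.AlgebraicGeometry.Motives.AbelianVarietyLevelAdjointFan
import HarnessLib

/-!
# Liu 2021, Appendix C/D glue — the Hecke endomorphism as a FAN WORD of piece entries, and the transposed word

[cite: Liu2021, p. 133 (before (D.3)): «`ℍ_K^{Σ₀} ⊆ End(A_K)_ℚ` denotes the image of the homomorphism `C_c^∞(K\G(𝔸_F^∞)/K, ℚ) → End(A_K)_ℚ`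
induced by the Hecke actions»; §4.2 (FJcycle.tex l. 2070–2074): `A_K := Alb(X_K)`, Hecke translates act through `Alb`]
[cite: Bump1997, §4.2 (Prop. 4.2.3): the double-coset operator `[KgK]` as a push–pull / sum of translates over `KgK/K`]
[cite: MumfordAV1970, §19 (Hom(X,Y) first paragraph; Thm. 3; `End⁰ = ℚ ⊗ End`)]
[cite: Lange2023AbelianVarietiesComplex, §4.5.2 (the norm map `N_f` of a finite morphism of curves)]

PROOF lane, generic over the [Liu2021] §4.2 record (`Sec42Data`, `HeckeTranslates`); sequel of ★ `HeckeEndomorphismComplexWord` (p761559: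
the complex push–pull word `Wt ≫ Σ_γ W_γ` of `[KgK]` on a piecewise model `Y_K = ⊞_c J(E_K c)` of `A_K ⊗ L`) and ★
`HeckeEndomorphismSingleTranslate` (p761943: `#(KγK/K) • (1 ⊗ (t ≫ Alb T_γ)) = #(K/N) • [KγK]`).  This file is the (hx)/(hxd) JUNCTION of the
d6 `stub_RosH` glue (road (P), level-structure adjointness on the complex model): it rewrites the words in the FAN NORMAL FORM
`Σ_i πY_K (a i) ≫ f i ≫ ιY_K (b i)` consumed by ★ `AbelianVariety.levelAdjoint_fan_sum` (one entry `f (γ, c′) = tt c′ ≫ Nm_{tp γ c′}` per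
translate `γ` and per piece `c′` of the deeper level), and it identifies the A-side partner of a ONE-TRANSLATE word at any normal level —
the shape in which the TRANSPOSED word (translates `γ⁻¹` through the refined levels `N″_γ`) is recognised as the image of an explicit
rational combination of Hecke endomorphisms, i.e. of an element of `ℍ_K` (★ `heckeImage`).

* §0 `AbelianVariety.fan_matrix_comp_sum` / `fan_matrix_comp_sum_product` — pure biproduct algebra: a column-matrix `Y_K → Y_N` times a SUM
  of row-matrices `Y_N → Y_K` is the fan sum of the entry products, indexed by (translate, piece).
* §1 (hx) `algEquiv_symm_endAlgebraBaseChange_heckeEnd_eq_smul_fan_sum` — through a matched `e : End⁰(Y_K) ≃ End⁰(A_K ⊗ L)`,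
  `e⁻¹(([KgK])_L) = #(K/N)⁻¹ • (1 ⊗ Σ_{(γ,c′)} πY_K (bN c′) ≫ (tt c′ ≫ Nm_{tp γ c′}) ≫ ιY_K (φ γ c′))`.
* §2 one translate: `of_trace_comp_albTr_eq_smul_heckeEnd` (`1 ⊗ (t ≫ Alb T_γ) = (#(K/N)/#(KγK/K)) • [KγK]`, ★ (N4′) divided),
  `algEquiv_symm_endAlgebraBaseChange_of_eq_of` (matched transport of honest endomorphisms),
  `algEquiv_symm_endAlgebraBaseChange_of_trace_comp_albTr_eq_fan_sum` and (hxd-brick)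
  `algEquiv_symm_endAlgebraBaseChange_heckeEnd_eq_smul_fan_sum_single`:
  `e⁻¹(([KγK])_L) = (#(KγK/K)/#(K/N)) • (1 ⊗ Σ_{c′} πY_K (bN c′) ≫ (tt c′ ≫ Nm_{tp c′}) ≫ ιY_K (φ c′))` — applied by the glue at
  `(γ⁻¹, N″_γ, K)`, one brick per translate.
* §3 linear combinations: `sum_smul_heckeEnd_mem_heckeImage`, `algEquiv_symm_endAlgebraBaseChange_sum_smul` — the transposed word
  `Σ_γ m_γ • word_γ` is `e⁻¹` of the base change of `Σ_γ (m_γ / q_γ) • [Kγ⁻¹K] ∈ ℍ_K`.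

All model data (pieces, Jacobians, fans `π/ι`, comparison isogenies `v`, `α`-compatibilities, piece maps, trace words) are HYPOTHESES, as in
★ `HeckeEndomorphismComplexWord`; no definition, no instance, no named fact, no `sorry`.
-/

open CategoryTheory CategoryTheory.Limits AlgebraicGeometry MonoidalCategory CartesianMonoidalCategory NumberField Function MulAction
open Literature.AlgebraicGeometry.Motives

/-! ## §0 Fan algebra: a column-matrix times a sum of row-matrices -/

namespace Literature.AlgebraicGeometry.Motives.AbelianVariety

universe u

variable {K₀ : Type u} [Field K₀]

/-- **Column-matrix times a SUM of row-matrices** (pure biproduct algebra, ★ `fan_matrix_comp` summed): with one entry `f c′ : J (a c′) → J′ c′`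
per column and, for each `j`, one entry `g j c′ : J′ c′ → J″ (b j c′)` per row, `(Σ_{c′} π (a c′) ≫ f c′ ≫ ι′ c′) ≫ Σ_j Σ_{c′} π′ c′ ≫ g j c′ ≫ ι″ (b j c′)
= Σ_j Σ_{c′} π (a c′) ≫ (f c′ ≫ g j c′) ≫ ι″ (b j c′)` — the shape of `Wt ≫ Σ_γ W_γ` (trace word times the translate words).
[cite: MumfordAV1970, §19 (Hom(X,Y), first paragraph)] -/
theorem fan_matrix_comp_sum {C' : Type*} [Fintype C'] [DecidableEq C'] {C C'' : Type*} {J : C → AbelianVariety K₀} {J' : C' → AbelianVariety K₀}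
    {J'' : C'' → AbelianVariety K₀} {Y Y' Y'' : AbelianVariety K₀}
    (π : ∀ c, Y ⟶ J c) (ι' : ∀ c', J' c' ⟶ Y') (π' : ∀ c', Y' ⟶ J' c') (ι'' : ∀ c'', J'' c'' ⟶ Y'')
    (hιπ'₁ : ∀ c', ι' c' ≫ π' c' = 𝟙 (J' c')) (hιπ'₂ : ∀ c₁ c₂, c₁ ≠ c₂ → ι' c₁ ≫ π' c₂ = 0)
    (a : C' → C) (f : ∀ c', J (a c') ⟶ J' c') {I : Type*} (sI : Finset I) (b : I → C' → C'')
    (g : ∀ j c', J' c' ⟶ J'' (b j c')) :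
    (∑ c', π (a c') ≫ f c' ≫ ι' c') ≫ (∑ j ∈ sI, ∑ c', π' c' ≫ g j c' ≫ ι'' (b j c')) =
      ∑ j ∈ sI, ∑ c', π (a c') ≫ (f c' ≫ g j c') ≫ ι'' (b j c') := by
  rw [Preadditive.comp_sum]
  exact Finset.sum_congr rfl fun j _ => fan_matrix_comp π ι' π' ι'' hιπ'₁ hιπ'₂ a (b j) f (g j)

/-- **The same, indexed by (translate, piece)**: `… = Σ_{(j,c′) ∈ sI × C′} π (a c′) ≫ (f c′ ≫ g j c′) ≫ ι″ (b j c′)` — the FAN NORMAL FORM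
`Σ_i π (a′ i) ≫ F i ≫ ι″ (b′ i)` of ★ `levelAdjoint_fan_sum` with `i = (j, c′)`, `a′ i = a c′`, `b′ i = b j c′`, `F i = f c′ ≫ g j c′`.
[cite: MumfordAV1970, §19 (Hom(X,Y), first paragraph)] -/
theorem fan_matrix_comp_sum_product {C' : Type*} [Fintype C'] [DecidableEq C'] {C C'' : Type*} {J : C → AbelianVariety K₀}
    {J' : C' → AbelianVariety K₀} {J'' : C'' → AbelianVariety K₀} {Y Y' Y'' : AbelianVariety K₀}
    (π : ∀ c, Y ⟶ J c) (ι' : ∀ c', J' c' ⟶ Y') (π' : ∀ c', Y' ⟶ J' c') (ι'' : ∀ c'', J'' c'' ⟶ Y'')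
    (hιπ'₁ : ∀ c', ι' c' ≫ π' c' = 𝟙 (J' c')) (hιπ'₂ : ∀ c₁ c₂, c₁ ≠ c₂ → ι' c₁ ≫ π' c₂ = 0)
    (a : C' → C) (f : ∀ c', J (a c') ⟶ J' c') {I : Type*} (sI : Finset I) (b : I → C' → C'')
    (g : ∀ j c', J' c' ⟶ J'' (b j c')) :
    (∑ c', π (a c') ≫ f c' ≫ ι' c') ≫ (∑ j ∈ sI, ∑ c', π' c' ≫ g j c' ≫ ι'' (b j c')) =
      ∑ i ∈ sI ×ˢ Finset.univ, π (a i.2) ≫ (f i.2 ≫ g i.1 i.2) ≫ ι'' (b i.1 i.2) := by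
  rw [fan_matrix_comp_sum π ι' π' ι'' hιπ'₁ hιπ'₂ a f sI b g, Finset.sum_product]

end Literature.AlgebraicGeometry.Motives.AbelianVariety

namespace Literature.NumberTheory.Automorphic.Liu2021.AppendixC

open AbelianVariety (bcSpec bcFunctor endAlgebra rationalTateModuleMap endAlgebraBaseChange)

-- `(A.baseChange L).X` is `(bcFunctor E L).obj A.X` only up to unfolding `AbelianVariety.baseChange` (as in ★ `HeckeEndomorphismComplexWord`)
set_option backward.isDefEq.respectTransparency false

variable {F E : Type} [Field F] [NumberField F] [IsTotallyReal F] [Field E] [NumberField E] [Algebra F E]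
  [IsTotallyComplex E] [Algebra.IsQuadraticExtension F E]
variable {P5 : PropC5Data F E} {isotropicAt : ℕ → Prop}

namespace Sec42Data.HeckeTranslates

variable {C : Sec42Data P5 isotropicAt} (T : C.HeckeTranslates) (L : Type) [Field L] [Algebra E L]
variable {N K : C5.SmallLevel C.S.K₀}
-- piecewise model of `A_N ⊗ L` (the deeper level), with its fan `πN/ιN`
variable {CN : Type} [Fintype CN] [DecidableEq CN] (EN : CN → SchemeOver L) (eN : ∀ c, EN c ⟶ (bcFunctor E L).obj (C.X N))
  (JN : ∀ c, Jacobian (EN c)) (YN : AbelianVariety L) (πN : ∀ c, YN ⟶ (JN c).J) (ιN : ∀ c, (JN c).J ⟶ YN)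
  (vN : YN ⟶ (C.A N).baseChange L) (lN : ∀ c, EN c ⊗ EN c ⟶ (bcFunctor E L).obj (C.alb N).nabla.N)
-- piecewise model of `A_K ⊗ L`, with its fan `πK/ιK`
variable {CK : Type} (EK : CK → SchemeOver L) (eK : ∀ c, EK c ⟶ (bcFunctor E L).obj (C.X K))
  (JK : ∀ c, Jacobian (EK c)) (YK : AbelianVariety L) (πK : ∀ c, YK ⟶ (JK c).J) (ιK : ∀ c, (JK c).J ⟶ YK)
  (vK : YK ⟶ (C.A K).baseChange L) (lK : ∀ c, EK c ⊗ EK c ⟶ (bcFunctor E L).obj (C.alb K).nabla.N)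

/-! ## §1 (hx): `[KgK]` through the matched `e` is a multiple of the fan word -/

section Hx

variable (htotN : ∑ c, πN c ≫ ιN c = 𝟙 YN)
  (hιπN : ∀ c, ιN c ≫ πN c = 𝟙 (JN c).J) (hιπN' : ∀ c₁ c₂, c₁ ≠ c₂ → ιN c₁ ≫ πN c₂ = 0)
  (hlN : ∀ c, lN c ≫ (bcFunctor E L).map (C.alb N).nabla.incl = (eN c ⊗ₘ eN c) ≫ Functor.LaxMonoidal.μ (bcFunctor E L) (C.X N) (C.X N))
  (hlαN : ∀ c, lN c ≫ (bcFunctor E L).map (C.alb N).α = (JN c).diff ≫ (ιN c ≫ vN).hom.hom.hom)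
  (hlK : ∀ c, lK c ≫ (bcFunctor E L).map (C.alb K).nabla.incl = (eK c ⊗ₘ eK c) ≫ Functor.LaxMonoidal.μ (bcFunctor E L) (C.X K) (C.X K))
  (hlαK : ∀ c, lK c ≫ (bcFunctor E L).map (C.alb K).α = (JK c).diff ≫ (ιK c ≫ vK).hom.hom.hom)
  {s : Finset C.G} (hsN : ∀ γ ∈ s, C5.HeckeLE γ N K)
  (φ : ↥s → CN → CK) (tp : ∀ (γ : ↥s) (c' : CN), EN c' ⟶ EK (φ γ c'))
  (htp : ∀ (γ : ↥s) (c' : CN), tp γ c' ≫ eK (φ γ c') = eN c' ≫ (bcFunctor E L).map (T.tr (γ : C.G) N K (hsN γ γ.2)))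
  (t : C.A K ⟶ C.A N) (bN : CN → CK) (tt : ∀ c', (JK (bN c')).J ⟶ (JN c').J)
  (hWt : (∑ c', πK (bN c') ≫ tt c' ≫ ιN c') ≫ vN = vK ≫ AbelianVariety.Hom.baseChange L t)

include htotN hιπN hιπN' hlN hlαN hlK hlαK htp hWt in
/-- **The complex push–pull word in fan normal form intertwines the honest push–pull**: with the Y-level trace word in matrix form
`Wt = Σ_{c′} πY_K (bN c′) ≫ tt c′ ≫ ιY_N c′` (one entry per piece `c′` of the deeper level, `bN c′` the piece of `X_K` below it) and the
translate words `W_γ = Σ_{c′} πY_N c′ ≫ Nm_{tp γ c′} ≫ ιY_K (φ γ c′)` (★ `albTr_baseChange_word`), the fan word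
`Σ_{(γ,c′)} πY_K (bN c′) ≫ (tt c′ ≫ Nm_{tp γ c′}) ≫ ιY_K (φ γ c′)` satisfies `word ≫ v_K = v_K ≫ (t ≫ Σ_γ Alb T_γ)_L`.
[cite: Liu2021, §4.2 (FJcycle.tex l. 2074) and p. 133 (before (D.3))] [cite: MumfordAV1970, §19 (Hom(X,Y), first paragraph)]
[cite: Lange2023AbelianVarietiesComplex, §4.5.2 (the norm map N_f)] -/
theorem fan_sum_comp_eq_comp_baseChange_pushPull :
    (∑ i ∈ s.attach ×ˢ Finset.univ,
        πK (bN i.2) ≫ (tt i.2 ≫ (JN i.2).pushforward (JK (φ i.1 i.2)) (tp i.1 i.2)) ≫ ιK (φ i.1 i.2)) ≫ vK =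
      vK ≫ AbelianVariety.Hom.baseChange L (t ≫ ∑ γ ∈ s.attach, T.albTr (γ : C.G) N K (hsN γ γ.2)) := by
  rw [← AbelianVariety.fan_matrix_comp_sum_product πK ιN πN ιK hιπN hιπN' bN tt s.attach φ
    (fun γ c' => (JN c').pushforward (JK (φ γ c')) (tp γ c'))]
  exact T.word_comp_eq_comp_baseChange_pushPull L EN eN JN YN πN ιN vN lN EK eK JK YK ιK vK lK htotN hlN hlαN hlK hlαK hsN φ tp
    htp t _ hWt

include htotN hιπN hιπN' hlN hlαN hlK hlαK htp hWt in
/-- **(hx) — `[KgK]` IS A RATIONAL MULTIPLE OF THE FAN WORD through the matched `e`**: for `e : End⁰(Y_K) ≃ End⁰(A_K ⊗ L)` matched to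
`v_K` (★ (J-b) shape: `ψ ≫ v_K = v_K ≫ φ′ → e (1 ⊗ ψ) = 1 ⊗ φ′`),
`e⁻¹ (([KgK])_L) = #ι⁻¹ • (1 ⊗ Σ_{(γ,c′) ∈ s × C_N} πY_K (bN c′) ≫ (tt c′ ≫ Nm_{tp γ c′}) ≫ ιY_K (φ γ c′))` — ★ THE WORD LEMMA
(`algEquiv_symm_endAlgebraBaseChange_heckeEnd_eq_word`) at the fan normal form; `s` a transversal of `KgK/K`, `t` the trace of the normal
level cover `X_N → X_K` pinned by `Alb_u ≫ t = Σ_i Alb T_{δ_i}` ((P3) ★ `heckeEnd_eq_pushPull`).  This is the letter `hx` of ★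
`levelAdjoint_fan_sum` / the d6 frame's `slot_letters` with `I := ↥s × C_N`, `a (γ,c′) := bN c′`, `b (γ,c′) := φ γ c′`,
`f (γ,c′) := tt c′ ≫ Nm_{tp γ c′}`, `q := #ι⁻¹`. [cite: Liu2021, p. 133 (before (D.3)) and §4.2 (FJcycle.tex l. 2074)] [cite: Bump1997, §4.2 (Prop. 4.2.3)]
[cite: MumfordAV1970, §19] -/
theorem algEquiv_symm_endAlgebraBaseChange_heckeEnd_eq_smul_fan_sum (ℓ : ℕ) [Fact ℓ.Prime] (hD : T.IsogenyDescent)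
    (hI : ∀ ⦃K K' : C5.SmallLevel C.S.K₀⦄ (f : K' ⟶ K), Function.Injective (rationalTateModuleMap ℓ (C.Atr f)).dualMap)
    (h : N ≤ K) (hn : ∀ k ∈ K.1.1, C5.HeckeLE k N N)
    {ι : Type*} [Fintype ι] [Nonempty ι] (δ : ι → C.G) (hδ : ∀ i, δ i ∈ K.1.1)
    (ht : C.Atr (homOfLE h) ≫ t = ∑ i, T.albTr (δ i) N N (hn _ (hδ i)))
    (g : C.G) (hs : Set.BijOn (fun x : C.G => (x : C.G ⧸ (K.1.1 : Subgroup C.G))) s (orbit K.1.1 (g : C.G ⧸ (K.1.1 : Subgroup C.G))))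
    (e : YK.endAlgebra ≃ₐ[ℚ] ((C.A K).baseChange L).endAlgebra)
    (he : ∀ (ψ : End YK) (φ' : End ((C.A K).baseChange L)), End.asHom ψ ≫ vK = vK ≫ End.asHom φ' →
      e (endAlgebra.of YK ψ) = endAlgebra.of ((C.A K).baseChange L) φ') :
    e.symm (endAlgebraBaseChange L (C.A K) (T.heckeEnd hD K g)) =
      ((Fintype.card ι : ℚ))⁻¹ •
        endAlgebra.of YK (∑ i ∈ s.attach ×ˢ Finset.univ,
          πK (bN i.2) ≫ (tt i.2 ≫ (JN i.2).pushforward (JK (φ i.1 i.2)) (tp i.1 i.2)) ≫ ιK (φ i.1 i.2)) := by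
  rw [T.algEquiv_symm_endAlgebraBaseChange_heckeEnd_eq_word L YK vK ℓ hD hI h hn δ hδ t ht g s hs hsN e he _
    (T.fan_sum_comp_eq_comp_baseChange_pushPull L EN eN JN YN πN ιN vN lN EK eK JK YK πK ιK vK lK htotN hιπN hιπN' hlN hlαN hlK
      hlαK hsN φ tp htp t bN tt hWt), Algebra.smul_def]

end Hx

/-! ## §2 One translate at a normal level: the A-side partner of a one-translate word -/

/-- **`1 ⊗ (t ≫ Alb T_γ) = (#ι / #(KγK/K)) • [KγK]` in `End⁰(A_K)`** — ★ (N4′) `ncard_smul_of_trace_comp_albTr_eq_card_smul_heckeEnd`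
divided by `#(KγK/K) ≠ 0` (the orbit is finite by hypothesis and contains `γK`). [cite: Liu2021, p. 133 (before (D.3)) and §4.2 (FJcycle.tex l. 2074)]
[cite: Bump1997, §4.2 (Prop. 4.2.3)] [cite: MumfordAV1970, §19 Thm. 3] -/
theorem of_trace_comp_albTr_eq_smul_heckeEnd (ℓ : ℕ) [Fact ℓ.Prime] (hD : T.IsogenyDescent)
    (hI : ∀ ⦃K K' : C5.SmallLevel C.S.K₀⦄ (f : K' ⟶ K), Function.Injective (rationalTateModuleMap ℓ (C.Atr f)).dualMap)
    (h : N ≤ K) (hn : ∀ k ∈ K.1.1, C5.HeckeLE k N N)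
    {ι : Type*} [Fintype ι] (δ : ι → C.G) (hδ : ∀ i, δ i ∈ K.1.1)
    (hsurjN : ∀ k ∈ K.1.1, ∃ i, (δ i)⁻¹ * k ∈ N.1.1) (hinjN : ∀ i j, (δ i)⁻¹ * δ j ∈ N.1.1 → i = j)
    (t : C.A K ⟶ C.A N) (ht : C.Atr (homOfLE h) ≫ t = ∑ i, T.albTr (δ i) N N (hn _ (hδ i)))
    (γ : C.G) (hγ : C5.HeckeLE γ N K) (hfin : (orbit K.1.1 (γ : C.G ⧸ (K.1.1 : Subgroup C.G))).Finite) :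
    endAlgebra.of (C.A K) (t ≫ T.albTr γ N K hγ) =
      ((Fintype.card ι : ℚ) / (orbit K.1.1 (γ : C.G ⧸ (K.1.1 : Subgroup C.G))).ncard) • T.heckeEnd hD K γ := by
  have H := T.ncard_smul_of_trace_comp_albTr_eq_card_smul_heckeEnd ℓ hD hI h hn δ hδ hsurjN hinjN t ht γ hγ
  have h0 : ((orbit K.1.1 (γ : C.G ⧸ (K.1.1 : Subgroup C.G))).ncard : ℚ) ≠ 0 :=
    Nat.cast_ne_zero.mpr ((Set.ncard_pos hfin).mpr ⟨_, mem_orbit_self _⟩).ne'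
  rw [← Nat.cast_smul_eq_nsmul ℚ, ← Nat.cast_smul_eq_nsmul ℚ] at H
  rw [div_eq_inv_mul, mul_smul, ← H, inv_smul_smul₀ h0]

/-- **Matched transport of an honest endomorphism**: if `e : End⁰(Y_K) ≃ End⁰(A_K ⊗ L)` is matched to `v_K` and `w ≫ v_K = v_K ≫ x_L`, then
`e⁻¹ ((1 ⊗ x)_L) = 1 ⊗ w` (★ `endAlgebraBaseChange_of`: `(1 ⊗ x)_L = 1 ⊗ x_L`). [cite: MumfordAV1970, §19] -/
theorem algEquiv_symm_endAlgebraBaseChange_of_eq_of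
    (e : YK.endAlgebra ≃ₐ[ℚ] ((C.A K).baseChange L).endAlgebra)
    (he : ∀ (ψ : End YK) (φ' : End ((C.A K).baseChange L)), End.asHom ψ ≫ vK = vK ≫ End.asHom φ' →
      e (endAlgebra.of YK ψ) = endAlgebra.of ((C.A K).baseChange L) φ')
    (x : End (C.A K)) (w : End YK) (hw : End.asHom w ≫ vK = vK ≫ AbelianVariety.Hom.baseChange L x) :
    e.symm (endAlgebraBaseChange L (C.A K) (endAlgebra.of (C.A K) x)) = endAlgebra.of YK w := by
  rw [AbelianVariety.endAlgebraBaseChange_of, ← he w _ hw, AlgEquiv.symm_apply_apply]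

section Single

variable (htotN : ∑ c, πN c ≫ ιN c = 𝟙 YN)
  (hιπN : ∀ c, ιN c ≫ πN c = 𝟙 (JN c).J) (hιπN' : ∀ c₁ c₂, c₁ ≠ c₂ → ιN c₁ ≫ πN c₂ = 0)
  (hlN : ∀ c, lN c ≫ (bcFunctor E L).map (C.alb N).nabla.incl = (eN c ⊗ₘ eN c) ≫ Functor.LaxMonoidal.μ (bcFunctor E L) (C.X N) (C.X N))
  (hlαN : ∀ c, lN c ≫ (bcFunctor E L).map (C.alb N).α = (JN c).diff ≫ (ιN c ≫ vN).hom.hom.hom)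
  (hlK : ∀ c, lK c ≫ (bcFunctor E L).map (C.alb K).nabla.incl = (eK c ⊗ₘ eK c) ≫ Functor.LaxMonoidal.μ (bcFunctor E L) (C.X K) (C.X K))
  (hlαK : ∀ c, lK c ≫ (bcFunctor E L).map (C.alb K).α = (JK c).diff ≫ (ιK c ≫ vK).hom.hom.hom)
  (γ : C.G) (hγ : C5.HeckeLE γ N K) (φ : CN → CK) (tp : ∀ c', EN c' ⟶ EK (φ c'))
  (htp : ∀ c', tp c' ≫ eK (φ c') = eN c' ≫ (bcFunctor E L).map (T.tr γ N K hγ))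
  (t : C.A K ⟶ C.A N) (bN : CN → CK) (tt : ∀ c', (JK (bN c')).J ⟶ (JN c').J)
  (hWt : (∑ c', πK (bN c') ≫ tt c' ≫ ιN c') ≫ vN = vK ≫ AbelianVariety.Hom.baseChange L t)

include htotN hιπN hιπN' hlN hlαN hlK hlαK htp hWt in
/-- **The one-translate fan word intertwines `t ≫ Alb T_γ`**: `(Σ_{c′} πY_K (bN c′) ≫ (tt c′ ≫ Nm_{tp c′}) ≫ ιY_K (φ c′)) ≫ v_K = v_K ≫ (t ≫ Alb T_γ)_L`
(★ `albTr_baseChange_word` times the trace word, ★ `fan_matrix_comp`). [cite: Liu2021, §4.2 (FJcycle.tex l. 2074)] [cite: MumfordAV1970, §19 (Hom(X,Y), first paragraph)]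
[cite: Lange2023AbelianVarietiesComplex, §4.5.2 (the norm map N_f)] -/
theorem fan_sum_single_comp_eq_comp_baseChange :
    (∑ c', πK (bN c') ≫ (tt c' ≫ (JN c').pushforward (JK (φ c')) (tp c')) ≫ ιK (φ c')) ≫ vK =
      vK ≫ AbelianVariety.Hom.baseChange L (t ≫ T.albTr γ N K hγ) := by
  rw [← AbelianVariety.fan_matrix_comp πK ιN πN ιK hιπN hιπN' bN φ tt (fun c' => (JN c').pushforward (JK (φ c')) (tp c')),
    Category.assoc, ← T.albTr_baseChange_word L EN eN JN YN πN ιN vN lN EK eK JK YK ιK vK lK htotN hlN hlαN hlK hlαK γ hγ φ tp htp,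
    ← Category.assoc, hWt, Category.assoc, ← AbelianVariety.Hom.baseChange_comp]

include htotN hιπN hιπN' hlN hlαN hlK hlαK htp hWt in
/-- **`e⁻¹ ((1 ⊗ (t ≫ Alb T_γ))_L) = 1 ⊗ (one-translate fan word)`** through a matched `e` (§2 transport + the intertwining above).
[cite: Liu2021, §4.2 (FJcycle.tex l. 2074) and p. 133 (before (D.3))] [cite: MumfordAV1970, §19] -/
theorem algEquiv_symm_endAlgebraBaseChange_of_trace_comp_albTr_eq_fan_sum
    (e : YK.endAlgebra ≃ₐ[ℚ] ((C.A K).baseChange L).endAlgebra)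
    (he : ∀ (ψ : End YK) (φ' : End ((C.A K).baseChange L)), End.asHom ψ ≫ vK = vK ≫ End.asHom φ' →
      e (endAlgebra.of YK ψ) = endAlgebra.of ((C.A K).baseChange L) φ') :
    e.symm (endAlgebraBaseChange L (C.A K) (endAlgebra.of (C.A K) (t ≫ T.albTr γ N K hγ))) =
      endAlgebra.of YK (∑ c', πK (bN c') ≫ (tt c' ≫ (JN c').pushforward (JK (φ c')) (tp c')) ≫ ιK (φ c')) :=
  algEquiv_symm_endAlgebraBaseChange_of_eq_of L YK vK e he _ _
    (T.fan_sum_single_comp_eq_comp_baseChange L EN eN JN YN πN ιN vN lN EK eK JK YK πK ιK vK lK htotN hιπN hιπN' hlN hlαN hlK hlαK γ hγ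
      φ tp htp t bN tt hWt)

include htotN hιπN hιπN' hlN hlαN hlK hlαK htp hWt in
/-- **(hxd-brick) — ONE HECKE ENDOMORPHISM THROUGH ONE TRANSLATE AT A NORMAL LEVEL**: with `t` the trace of the normal level cover `X_N → X_K`
(pinned by `Alb_u ≫ t = Σ_i Alb T_{δ_i}`, `δ` a system of representatives of `K/N`) and ONE translate `T_γ : X_N → X_K`,
`e⁻¹ (([KγK])_L) = (#(KγK/K) / #ι) • (1 ⊗ Σ_{c′} πY_K (bN c′) ≫ (tt c′ ≫ Nm_{tp c′}) ≫ ιY_K (φ c′))` — no transversal of `KγK/K`, no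
degree hypothesis.  The d6 glue applies it at `(γ⁻¹, N″_γ, K)` for each translate `γ` of `[KgK]` (`N″_γ ⊴ K`, `N″_γ ⊆ γ⁻¹Nγ`): the TRANSPOSED
entries of the fan word of `[KgK]` run through the pieces of `X_{N″_γ}`, and this brick names their A-side partner `[Kγ⁻¹K] ∈ ℍ_K`.
[cite: Liu2021, p. 133 (before (D.3)) and §4.2 (FJcycle.tex l. 2074)] [cite: Bump1997, §4.2 (Prop. 4.2.3)] [cite: MumfordAV1970, §19 Thm. 3] -/
theorem algEquiv_symm_endAlgebraBaseChange_heckeEnd_eq_smul_fan_sum_single (ℓ : ℕ) [Fact ℓ.Prime] (hD : T.IsogenyDescent)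
    (hI : ∀ ⦃K K' : C5.SmallLevel C.S.K₀⦄ (f : K' ⟶ K), Function.Injective (rationalTateModuleMap ℓ (C.Atr f)).dualMap)
    (h : N ≤ K) (hn : ∀ k ∈ K.1.1, C5.HeckeLE k N N)
    {ι : Type*} [Fintype ι] [Nonempty ι] (δ : ι → C.G) (hδ : ∀ i, δ i ∈ K.1.1)
    (hsurjN : ∀ k ∈ K.1.1, ∃ i, (δ i)⁻¹ * k ∈ N.1.1) (hinjN : ∀ i j, (δ i)⁻¹ * δ j ∈ N.1.1 → i = j)
    (ht : C.Atr (homOfLE h) ≫ t = ∑ i, T.albTr (δ i) N N (hn _ (hδ i)))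
    (hfin : (orbit K.1.1 (γ : C.G ⧸ (K.1.1 : Subgroup C.G))).Finite)
    (e : YK.endAlgebra ≃ₐ[ℚ] ((C.A K).baseChange L).endAlgebra)
    (he : ∀ (ψ : End YK) (φ' : End ((C.A K).baseChange L)), End.asHom ψ ≫ vK = vK ≫ End.asHom φ' →
      e (endAlgebra.of YK ψ) = endAlgebra.of ((C.A K).baseChange L) φ') :
    e.symm (endAlgebraBaseChange L (C.A K) (T.heckeEnd hD K γ)) =
      (((orbit K.1.1 (γ : C.G ⧸ (K.1.1 : Subgroup C.G))).ncard : ℚ) / Fintype.card ι) •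
        endAlgebra.of YK (∑ c', πK (bN c') ≫ (tt c' ≫ (JN c').pushforward (JK (φ c')) (tp c')) ≫ ιK (φ c')) := by
  have hι : (Fintype.card ι : ℚ) ≠ 0 := Nat.cast_ne_zero.mpr Fintype.card_ne_zero
  have h0 : ((orbit K.1.1 (γ : C.G ⧸ (K.1.1 : Subgroup C.G))).ncard : ℚ) ≠ 0 :=
    Nat.cast_ne_zero.mpr ((Set.ncard_pos hfin).mpr ⟨_, mem_orbit_self _⟩).ne'
  have H := T.of_trace_comp_albTr_eq_smul_heckeEnd ℓ hD hI h hn δ hδ hsurjN hinjN t ht γ hγ hfin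
  have H' : T.heckeEnd hD K γ =
      (((orbit K.1.1 (γ : C.G ⧸ (K.1.1 : Subgroup C.G))).ncard : ℚ) / Fintype.card ι) • endAlgebra.of (C.A K) (t ≫ T.albTr γ N K hγ) := by
    rw [H, smul_smul, div_mul_div_comm, mul_comm, div_self (mul_ne_zero hι h0), one_smul]
  rw [H', map_smul, map_smul,
    T.algEquiv_symm_endAlgebraBaseChange_of_trace_comp_albTr_eq_fan_sum L EN eN JN YN πN ιN vN lN EK eK JK YK πK ιK vK lK htotN hιπN
      hιπN' hlN hlαN hlK hlαK γ hγ φ tp htp t bN tt hWt e he]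

end Single

/-! ## §3 Linear combinations: the transposed word and its partner in `ℍ_K` -/

/-- **Rational combinations of Hecke endomorphisms lie in `ℍ_K`** (★ `heckeImage` is a subalgebra containing every `[KgK]`).
[cite: Liu2021, p. 133 (before (D.3))] -/
theorem sum_smul_heckeEnd_mem_heckeImage (hD : T.IsogenyDescent) (K : C5.SmallLevel C.S.K₀) {I : Type*} (sI : Finset I)
    (q : I → ℚ) (gs : I → C.G) : ∑ j ∈ sI, q j • T.heckeEnd hD K (gs j) ∈ T.heckeImage hD K :=
  Subalgebra.sum_mem _ fun j _ => Subalgebra.smul_mem _ (T.heckeEnd_mem_heckeImage hD K (gs j)) _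

/-- **The transposed word is `e⁻¹` of an element of `End⁰(A_K)`**: if each brick satisfies `e⁻¹ ((x j)_L) = q j • (1 ⊗ w j)` with `q j ≠ 0`
(§2, one per translate), then for integer weights `m j` (the weight equalisation of ★ `levelAdjoint_fan_sum_weighted`),
`e⁻¹ ((Σ_j (m j / q j) • x j)_L) = 1 ⊗ Σ_j m j • w j`.  With `x j := [Kγ_j⁻¹K]` the left argument lies in `ℍ_K`
(`sum_smul_heckeEnd_mem_heckeImage`): this is the letter `hxd` of the d6 frame's `slot_letters`. [cite: Liu2021, p. 133 (before (D.3))]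
[cite: MumfordAV1970, §19] -/
theorem algEquiv_symm_endAlgebraBaseChange_sum_smul (e : YK.endAlgebra ≃ₐ[ℚ] ((C.A K).baseChange L).endAlgebra)
    {I : Type*} (sI : Finset I) (x : I → (C.A K).endAlgebra) (w : I → End YK) (q : I → ℚ) (m : I → ℤ)
    (hq : ∀ j ∈ sI, q j ≠ 0) (hx : ∀ j ∈ sI, e.symm (endAlgebraBaseChange L (C.A K) (x j)) = q j • endAlgebra.of YK (w j)) :
    e.symm (endAlgebraBaseChange L (C.A K) (∑ j ∈ sI, ((m j : ℚ) / q j) • x j)) = endAlgebra.of YK (∑ j ∈ sI, m j • w j) := by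
  rw [map_sum, map_sum, show endAlgebra.of YK (∑ j ∈ sI, m j • w j) = ∑ j ∈ sI, endAlgebra.of YK (m j • w j) from
    map_sum (endAlgebra.of YK).toAddMonoidHom _ sI]
  refine Finset.sum_congr rfl fun j hj => ?_
  have hmq : ((m j : ℚ) / q j) * q j = m j := div_mul_cancel₀ _ (hq j hj)
  rw [map_smul, map_smul, hx j hj, smul_smul, hmq, show endAlgebra.of YK (m j • w j) = m j • endAlgebra.of YK (w j) from
    map_zsmul (endAlgebra.of YK).toAddMonoidHom _ _]
  exact Int.cast_smul_eq_zsmul ℚ (m j) _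

end Sec42Data.HeckeTranslates

end Literature.NumberTheory.Automorphic.Liu2021.AppendixC
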